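import Summits.QuantumFields.BalabanUV.Beta.GAN24.TransversalZeroMode
import Summits.QuantumFields.BalabanUV.Beta.GAN24.T2SlotUnits

/-!
# `BalabanUV.Beta.GAN24.T2OfValueCovariance` — binder row G-an2-4 / (CONV-C), W-slot road «W3» (SKELETON-W3 v1.0 §8.3/§8.5,
# TRIGGER-W scope_update_53 (w2), ref2 REF2-DAG-AUDIT-r53 R53-2 «F4d-cov»): the VALUE PARTS of an2's recursive Stage-B bi-stencil
# family `BalabanStepW2.T2Of` are covariant under ALL unit translations of their lattice, the members are so SLOT-WISE ON THE
# FIELD–FIELD BLOCK, and slot-wise covariance is all that leaf-16's cell ⟷ pointwise zero-mode bridge needs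

NOT IN PRINT; OUR BOOKKEEPING (G-an2-4 formalisation swarm, leaf prover `b2b-balaban-gan24-formalise-leaf-11`, gen 18; journal INTENT
«W3-FFCOV*» — the `t`-shape (all unit translations) half of ref2's sub-obligation «F4d-cov»; the joint BLOCK shape `u ↦ u + Lc•t` of the
whole normalised tables is leaf-19's «T2-COV*» (`GAN24/T2SlotCovariance`), disjoint by shift shape; module name PROVISIONAL — the row owner
gan24-p1 may rename / re-home it).  HONEST FRAMING (cell contract, verbatim): «discharging `BetaPertH` makes Bałaban's UV stability
UNCONDITIONAL — a real constructive-QFT result; it is NOT the continuum limit and NOT the Clay problem.»  HONEST DEPENDENCY (verbatim):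
«continuum YM on T⁴ ⇐ BetaPertH ∧ nine spine estimates (0/9 proved); BetaPertH ⇐ (D1) ∧ (D4) ∧ CAP+tail; G-an2-4 gates asym, D1 and NE2/3/4.»

WHY.  The `Zfree` parameter OF RECORD of the owner's W3 ENDs (`GAN24/WSlotT2OfPieces.shape_of_rows` / `rate_of_rows`) is the POINTWISE
transversal field–field zero mode `∀ κ u κ′ α β, Σ'_{u′} Σ'_x Σ'_z X κ u κ′ u′ x z (inl α) (inl β) = 0` (TRIGGER-W (w2)), while leaf-02's (Z0)
identities (`LinT2ZeroMode*`) and leaf-07's F4d pin side (`WSlotFirstDiff.hZ0_iff_chargeConserved`) are written in the CELL currency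
`BiStencilZeroMode.zmode Lc X κ κ′ (inl α) (inl β) = 0`.  leaf-16's bridge `TransversalZeroMode.zmode_ff_eq_zero_iff_pointwise` converts one into
the other for tables covariant under EVERY unit translation `t` of their own lattice AS WHOLE TABLES
(`X κ (u + t) κ′ (u′ + t) = shiftK (−t) (X κ u κ′ u′)`).  The members `T2Of … j` are NOT of this kind as whole tables — their border summand
`(cB·wB2 j) • (mfNeg ∘ vh₂S)` is only block-covariant (`BalabanStepW2.T2Of_translate` is stated at `Lc•t`) — but:
(a) their VALUE parts `cE₂ • wilsonW₂ d Tc` (member `0`) and `(cE₂·wV4 (j+1)) • e4OfW j (Spure j) (M1 j) (WbalOf … (T2Of …) mixFF j)`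
    (member `j+1`) ARE covariant under all unit translations — an3's `WilsonBiStencil.wilsonW₂_translate` and an2's
    `BalabanStepW2.e4OfW_translate` fed with `Spure_translate`, `M1_translate`, `WbalOf_translate ∘ T2Of_translate` (the block covariance of the
    step-`j` data is exactly what `e4OfW_translate` consumes; its output is covariance under ALL translations of the step-`(j+1)` lattice);
(b) an1's border table has NO field–field (and no multiplier–multiplier) entries (`AveragingMixedJetTables.vh₂SAt` is
    `AveragingHessianKernels.packVH` of a kernel, off-diagonal by definition) and `StepJetData.mfNeg` copies the field–field block.
Hence every member, every normalised member `unitS₂ s_f s_m (T2Of … j)` (leaf-19's `T2SlotUnits` currency; any units) and every first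
difference `T♮_{n+1} − T♮_n` of the owner's difference tower is covariant SLOT-WISE ON THE FIELD–FIELD BLOCK, and §1 shows that slot-wise
covariance is all the bridge needs.  (The companion module `GAN24/T2OfDiffCovariance` adds the whole-table statement ref2 asked for
literally — «1-covariance of `T♮₁ − T♮₀`»: in the adopted units the normalised border is `j`-FREE (leaf-19's `T2SlotUnits.unitS₂_border_eq`),
so it CANCELS in every first difference — and the instances at an1's tables.)

WHAT ([folklore] re-indexing of nested `tsum`s + composition of an1/an2/an3's own covariance theorems BY NAME; generic `d`; `1 ≤ Lc`;
every `j`; all colour constants SYMBOLIC; ANY border binder `vh₂S` under `hBt` (block covariance — an1's `vh₂SAt_translate` at any root)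
and `hBff` (zero field–field block — `rfl` for `vh₂SAt`), ANY mixed table under `hmixt` (an1's `mixFFAt_translate` at any root)):
* §1 slot-wise form of leaf-16's §1–§3: `slot_translate_of_translate`, `inner_eq_inner_zero_slot`, `zmode_eq_pow_mul_inner_slot`,
  `inner_eq_zero_of_zmode_eq_zero_slot`, `zmode_eq_zero_iff_inner_eq_zero_slot`, **`zmode_ff_eq_zero_iff_pointwise_of_ff`**; closure of
  slot-wise covariance under `+`, `−`, `c •`, `unitS₂` (`slot_translate_add/sub/smul`, `unitS₂_slot_translate`).
* §2 `wilsonW₂_slot_translate`, `T2Of_val_succ_translate` (the member-`(j+1)` value part as a WHOLE table), **`T2Of_ff_translate`**,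
  `unitS₂_T2Of_ff_translate`, `firstDiff_ff_translate`.
* §3 the bridges: **`zmode_ff_unitS₂_T2Of_iff_pointwise`**, `zmode_ff_T2Of_iff_pointwise`, **`zmode_ff_firstDiff_iff_pointwise`** (`N ≠ 0`).
* companion module `GAN24/T2OfDiffCovariance` (§4–§5): the instances at an1's tables at ANY root (all binder hypotheses discharged by
  name) and the WHOLE-TABLE covariance of every first difference `T♮_{n+1} − T♮_n` (the `j`-free normalised border cancels).
0 `def`, 0 cite, 0 `def … : Prop`, 0 sorry.  Asserts NO shape and NO zero-mode VALUE of Bałaban's tables; pins no colour constant; NOT a row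
of SKELETON-W3 §8.3 (rule (h) count unaffected); discharges NOTHING of «T2Shape» / «T2SupRate» / (hW, hWall); 0/2 W wall binders; NOT «W-slot
closed», NEVER «G-an2-4 closed», NOT (CONV-C); NOT BetaPertH, NOT continuum, NOT Clay.
-/

noncomputable section

open Finset
open scoped BigOperators
open Literature.MathematicalPhysics.QuantumFieldTheory
open Literature.MathematicalPhysics.QuantumFieldTheory.Balaban1983to89
open Literature.MathematicalPhysics.QuantumFieldTheory.Balaban1983to89.Beta
open ExpKernelCalculus (MKer shiftK)
open OneStepResolventKernel (Fib)
open AffineAveraging (box toSite)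
open StepJetData (mfNeg mfNeg_inl_inl mfNeg_inr_inr)
open BalabanStepW2 (wV4 wB2 Spure M1 WbalOf e4OfW T2Of T2Of_zero T2Of_succ Spure_translate M1_translate WbalOf_translate T2Of_translate
  e4OfW_translate)
open WilsonBiStencil (wilsonW₂ wilsonW₂_translate)
open AveragingMixedJetTables (vh₂S vh₂SAt mixFFAt vh₂SAt_translate vh₂S_translate mixFFAt_translate)
open AveragingHessianKernels (packVH_inl_inl packVH_inr_inr)
open Summit.QuantumFields.BalabanUV.Beta.HessKerDressedUnits (legScale)
open Summit.QuantumFields.BalabanUV.Beta.SecondOrderUnits (unitS₂)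
open Summit.QuantumFields.BalabanUV.Beta.GAN24.CombesThomas (sfStep smStep)
open Summit.QuantumFields.BalabanUV.Beta.GAN24.T2SlotUnits (unitS₂_apply unitS₂_add unitS₂_border_eq unitS₂_step_zero)
open Summit.QuantumFields.BalabanUV.Beta.GAN24.BiStencilZeroMode (Tab zmode)
open Summit.QuantumFields.BalabanUV.Beta.GAN24.TransversalZeroMode (card_box_succ zmode_eq_zero_of_inner_eq_zero translate_sub
  translate_fibreScale)

namespace Summit.QuantumFields.BalabanUV.Beta.GAN24.T2OfValueCovariance

variable {d : ℕ}

/-! ## §1 Slot-wise covariance under all unit translations, and the cell ⟷ pointwise bridge it affords -/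

section Slot

variable {X Y : Tab d} {a b : Fib d}

/-- [folklore] A table covariant under all unit translations AS A WHOLE (leaf-16's hypothesis shape, `shiftK (−t)`) is covariant
SLOT-WISE at every fibre pair `(a, b)`: `X κ (u + t) κ′ (u′ + t) x z a b = X κ u κ′ u′ (x − t) (z − t) a b`. -/
theorem slot_translate_of_translate
    (hX : ∀ (κ : Fin (d + 1)) (u : Fin (d + 1) → ℤ) (κ' : Fin (d + 1)) (u' t : Fin (d + 1) → ℤ),
      X κ (u + t) κ' (u' + t) = shiftK (-t) (X κ u κ' u'))
    (a b : Fib d) (κ : Fin (d + 1)) (u : Fin (d + 1) → ℤ) (κ' : Fin (d + 1)) (u' t x z : Fin (d + 1) → ℤ) :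
    X κ (u + t) κ' (u' + t) x z a b = X κ u κ' u' (x + -t) (z + -t) a b := by
  rw [hX]
  rfl

/-- [folklore] **THE INNER SUM OF A SLOT-WISE COVARIANT TABLE IS CONSTANT IN THE FIRST BOND** (leaf-02's `inner_periodic` re-indexing at
period `1`, one fibre pair; no summability needed). -/
theorem inner_eq_inner_zero_slot
    (hX : ∀ (κ : Fin (d + 1)) (u : Fin (d + 1) → ℤ) (κ' : Fin (d + 1)) (u' t x z : Fin (d + 1) → ℤ),
      X κ (u + t) κ' (u' + t) x z a b = X κ u κ' u' (x + -t) (z + -t) a b)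
    (κ κ' : Fin (d + 1)) (u : Fin (d + 1) → ℤ) :
    (∑' u', ∑' x, ∑' z, X κ u κ' u' x z a b) = ∑' u', ∑' x, ∑' z, X κ 0 κ' u' x z a b := by
  have step : ∀ G : (Fin (d + 1) → ℤ) → ℝ, ∑' v, G v = ∑' v, G (v + u) := fun G =>
    ((Equiv.addRight u).tsum_eq G).symm
  rw [step fun u' => ∑' x, ∑' z, X κ u κ' u' x z a b]
  refine tsum_congr fun u' => ?_
  rw [step fun x => ∑' z, X κ u κ' (u' + u) x z a b]
  refine tsum_congr fun x => ?_
  rw [step fun z => X κ u κ' (u' + u) (x + u) z a b]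
  refine tsum_congr fun z => ?_
  have h := hX κ 0 κ' u' u (x + u) (z + u)
  rw [zero_add, add_neg_cancel_right, add_neg_cancel_right] at h
  exact h

/-- [folklore] `zmode N X κ κ′ a b = N^{d+1} · (inner sum at the origin)` for a table slot-wise covariant at `(a, b)`. -/
theorem zmode_eq_pow_mul_inner_slot {N : ℕ}
    (hX : ∀ (κ : Fin (d + 1)) (u : Fin (d + 1) → ℤ) (κ' : Fin (d + 1)) (u' t x z : Fin (d + 1) → ℤ),
      X κ (u + t) κ' (u' + t) x z a b = X κ u κ' u' (x + -t) (z + -t) a b)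
    (κ κ' : Fin (d + 1)) :
    zmode N X κ κ' a b = ((N : ℝ)) ^ (d + 1) * ∑' u', ∑' x, ∑' z, X κ 0 κ' u' x z a b := by
  unfold zmode
  rw [Finset.sum_congr rfl fun r _ => inner_eq_inner_zero_slot hX κ κ' (toSite r), Finset.sum_const, card_box_succ, nsmul_eq_mul]
  push_cast
  ring

/-- [folklore] CELL ZERO MODE ⇒ POINTWISE ZERO MODE at one fibre pair, for a slot-wise covariant table and `N ≠ 0`. -/
theorem inner_eq_zero_of_zmode_eq_zero_slot {N : ℕ} (hN : N ≠ 0)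
    (hX : ∀ (κ : Fin (d + 1)) (u : Fin (d + 1) → ℤ) (κ' : Fin (d + 1)) (u' t x z : Fin (d + 1) → ℤ),
      X κ (u + t) κ' (u' + t) x z a b = X κ u κ' u' (x + -t) (z + -t) a b)
    {κ κ' : Fin (d + 1)} (hZ : zmode N X κ κ' a b = 0) (u : Fin (d + 1) → ℤ) :
    (∑' u', ∑' x, ∑' z, X κ u κ' u' x z a b) = 0 := by
  rw [inner_eq_inner_zero_slot hX κ κ' u]
  rw [zmode_eq_pow_mul_inner_slot hX κ κ'] at hZ
  have hpow : ((N : ℝ)) ^ (d + 1) ≠ 0 := pow_ne_zero _ (Nat.cast_ne_zero.mpr hN)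
  rcases mul_eq_zero.mp hZ with h | h
  · exact absurd h hpow
  · exact h

/-- [folklore] THE TWO FORMS ARE EQUIVALENT at one fibre pair, for a slot-wise covariant table and `N ≠ 0`. -/
theorem zmode_eq_zero_iff_inner_eq_zero_slot {N : ℕ} (hN : N ≠ 0)
    (hX : ∀ (κ : Fin (d + 1)) (u : Fin (d + 1) → ℤ) (κ' : Fin (d + 1)) (u' t x z : Fin (d + 1) → ℤ),
      X κ (u + t) κ' (u' + t) x z a b = X κ u κ' u' (x + -t) (z + -t) a b)
    (κ κ' : Fin (d + 1)) :
    zmode N X κ κ' a b = 0 ↔ ∀ u : Fin (d + 1) → ℤ, (∑' u', ∑' x, ∑' z, X κ u κ' u' x z a b) = 0 :=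
  ⟨fun hZ u => inner_eq_zero_of_zmode_eq_zero_slot hN hX hZ u, fun hI => zmode_eq_zero_of_inner_eq_zero N hI⟩

/-- [folklore] **leaf-16's ff BRIDGE UNDER FIELD–FIELD SLOT COVARIANCE ONLY**: if every field–field slot of `X` is covariant under all unit
translations, then leaf-02's cell form `∀ κ κ′ α β, zmode N X κ κ′ (inl α) (inl β) = 0` is equivalent to the POINTWISE transversal form
`∀ κ u κ′ α β, Σ'_{u′xz} X κ u κ′ u′ x z (inl α) (inl β) = 0` of record (TRIGGER-W (w2)) — the off-diagonal blocks of `X` may be anything. -/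
theorem zmode_ff_eq_zero_iff_pointwise_of_ff {N : ℕ} (hN : N ≠ 0) {X : Tab d}
    (hX : ∀ (α β κ : Fin (d + 1)) (u : Fin (d + 1) → ℤ) (κ' : Fin (d + 1)) (u' t x z : Fin (d + 1) → ℤ),
      X κ (u + t) κ' (u' + t) x z (Sum.inl α) (Sum.inl β) = X κ u κ' u' (x + -t) (z + -t) (Sum.inl α) (Sum.inl β)) :
    (∀ (κ κ' α β : Fin (d + 1)), zmode N X κ κ' (Sum.inl α) (Sum.inl β) = 0) ↔
      ∀ (κ : Fin (d + 1)) (u : Fin (d + 1) → ℤ) (κ' α β : Fin (d + 1)),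
        (∑' u', ∑' x, ∑' z, X κ u κ' u' x z (Sum.inl α) (Sum.inl β)) = 0 :=
  ⟨fun h κ u κ' α β => inner_eq_zero_of_zmode_eq_zero_slot hN (hX α β) (h κ κ' α β) u,
    fun h κ κ' α β => zmode_eq_zero_of_inner_eq_zero N fun u => h κ u κ' α β⟩

/-- [folklore] Slot-wise covariance is preserved by sums (the tables written as lambdas, as in the END texts). -/
theorem slot_translate_add
    (hX : ∀ (κ : Fin (d + 1)) (u : Fin (d + 1) → ℤ) (κ' : Fin (d + 1)) (u' t x z : Fin (d + 1) → ℤ),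
      X κ (u + t) κ' (u' + t) x z a b = X κ u κ' u' (x + -t) (z + -t) a b)
    (hY : ∀ (κ : Fin (d + 1)) (u : Fin (d + 1) → ℤ) (κ' : Fin (d + 1)) (u' t x z : Fin (d + 1) → ℤ),
      Y κ (u + t) κ' (u' + t) x z a b = Y κ u κ' u' (x + -t) (z + -t) a b)
    (κ : Fin (d + 1)) (u : Fin (d + 1) → ℤ) (κ' : Fin (d + 1)) (u' t x z : Fin (d + 1) → ℤ) :
    (fun κ u κ' u' => X κ u κ' u' + Y κ u κ' u') κ (u + t) κ' (u' + t) x z a b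
      = (fun κ u κ' u' => X κ u κ' u' + Y κ u κ' u') κ u κ' u' (x + -t) (z + -t) a b := by
  show (X κ (u + t) κ' (u' + t) + Y κ (u + t) κ' (u' + t)) x z a b = (X κ u κ' u' + Y κ u κ' u') (x + -t) (z + -t) a b
  simp only [Pi.add_apply]
  rw [hX, hY]

/-- [folklore] Slot-wise covariance is preserved by differences (the first differences / forcings of the W3 difference tower). -/
theorem slot_translate_sub
    (hX : ∀ (κ : Fin (d + 1)) (u : Fin (d + 1) → ℤ) (κ' : Fin (d + 1)) (u' t x z : Fin (d + 1) → ℤ),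
      X κ (u + t) κ' (u' + t) x z a b = X κ u κ' u' (x + -t) (z + -t) a b)
    (hY : ∀ (κ : Fin (d + 1)) (u : Fin (d + 1) → ℤ) (κ' : Fin (d + 1)) (u' t x z : Fin (d + 1) → ℤ),
      Y κ (u + t) κ' (u' + t) x z a b = Y κ u κ' u' (x + -t) (z + -t) a b)
    (κ : Fin (d + 1)) (u : Fin (d + 1) → ℤ) (κ' : Fin (d + 1)) (u' t x z : Fin (d + 1) → ℤ) :
    (fun κ u κ' u' => X κ u κ' u' - Y κ u κ' u') κ (u + t) κ' (u' + t) x z a b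
      = (fun κ u κ' u' => X κ u κ' u' - Y κ u κ' u') κ u κ' u' (x + -t) (z + -t) a b := by
  show (X κ (u + t) κ' (u' + t) - Y κ (u + t) κ' (u' + t)) x z a b = (X κ u κ' u' - Y κ u κ' u') (x + -t) (z + -t) a b
  simp only [Pi.sub_apply]
  rw [hX, hY]

/-- [folklore] Slot-wise covariance is preserved by scalar multiples. -/
theorem slot_translate_smul (c : ℝ)
    (hX : ∀ (κ : Fin (d + 1)) (u : Fin (d + 1) → ℤ) (κ' : Fin (d + 1)) (u' t x z : Fin (d + 1) → ℤ),
      X κ (u + t) κ' (u' + t) x z a b = X κ u κ' u' (x + -t) (z + -t) a b)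
    (κ : Fin (d + 1)) (u : Fin (d + 1) → ℤ) (κ' : Fin (d + 1)) (u' t x z : Fin (d + 1) → ℤ) :
    (fun κ u κ' u' => c • X κ u κ' u') κ (u + t) κ' (u' + t) x z a b
      = (fun κ u κ' u' => c • X κ u κ' u') κ u κ' u' (x + -t) (z + -t) a b := by
  show (c • X κ (u + t) κ' (u' + t)) x z a b = (c • X κ u κ' u') (x + -t) (z + -t) a b
  simp only [Pi.smul_apply]
  rw [hX]

/-- [folklore] **THE CHANGE OF UNITS `unitS₂` PRESERVES SLOT-WISE COVARIANCE** (any real units; it is an entrywise fibre re-weighting,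
leaf-19's `T2SlotUnits.unitS₂_apply`). -/
theorem unitS₂_slot_translate (sf sm : ℝ)
    (hX : ∀ (κ : Fin (d + 1)) (u : Fin (d + 1) → ℤ) (κ' : Fin (d + 1)) (u' t x z : Fin (d + 1) → ℤ),
      X κ (u + t) κ' (u' + t) x z a b = X κ u κ' u' (x + -t) (z + -t) a b)
    (κ : Fin (d + 1)) (u : Fin (d + 1) → ℤ) (κ' : Fin (d + 1)) (u' t x z : Fin (d + 1) → ℤ) :
    unitS₂ sf sm X κ (u + t) κ' (u' + t) x z a b = unitS₂ sf sm X κ u κ' u' (x + -t) (z + -t) a b := by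
  rw [unitS₂_apply, unitS₂_apply, hX]

end Slot

/-! ## §2 The value parts of an2's `T2Of` are covariant under all unit translations; the members are so on the field–field block -/

section Members

variable {Lc : ℕ} [NeZero Lc]

omit [NeZero Lc] in
/-- [folklore] an3's Wilson bi-stencil, slot-wise (`WilsonBiStencil.wilsonW₂_translate`, every fibre pair). -/
theorem wilsonW₂_slot_translate (T : Fin 4 → Fin 4 → Fin 4 → Fin 4 → ℝ) (a b : Fib d)
    (κ : Fin (d + 1)) (u : Fin (d + 1) → ℤ) (κ' : Fin (d + 1)) (u' t x z : Fin (d + 1) → ℤ) :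
    wilsonW₂ d T κ (u + t) κ' (u' + t) x z a b = wilsonW₂ d T κ u κ' u' (x + -t) (z + -t) a b := by
  rw [wilsonW₂_translate]
  rfl

variable (hLc : 1 ≤ Lc) (cE cVH cΛ cE₂ cB : ℝ) (T : Fin 4 → Fin 4 → Fin 4 → Fin 4 → ℝ)
  {vh₂S : Tab d}
  (hBt : ∀ (κ : Fin (d + 1)) (u : Fin (d + 1) → ℤ) (κ' : Fin (d + 1)) (u' t : Fin (d + 1) → ℤ),
    vh₂S κ (u + (Lc : ℤ) • t) κ' (u' + (Lc : ℤ) • t) = shiftK (-((Lc : ℤ) • t)) (vh₂S κ u κ' u'))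
  (hBff : ∀ (κ : Fin (d + 1)) (u : Fin (d + 1) → ℤ) (κ' : Fin (d + 1)) (u' x z : Fin (d + 1) → ℤ) (α β : Fin (d + 1)),
    vh₂S κ u κ' u' x z (Sum.inl α) (Sum.inl β) = 0)
  {mixFF : Tab d}
  (hmixt : ∀ (κ : Fin (d + 1)) (u : Fin (d + 1) → ℤ) (ρ : Fin (d + 1)) (w t : Fin (d + 1) → ℤ),
    mixFF κ (u + (Lc : ℤ) • t) ρ (w + t) = shiftK (-((Lc : ℤ) • t)) (mixFF κ u ρ w))

include hLc hBt hmixt in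
/-- [folklore] **THE VALUE PART OF MEMBER `j+1` IS COVARIANT UNDER ALL UNIT TRANSLATIONS OF ITS LATTICE, AS A WHOLE TABLE** — an2's
`e4OfW_translate` fed with `Spure_translate`, `M1_translate` and `WbalOf_translate ∘ T2Of_translate` (the joint block covariance of the
step-`j` data under the two binder covariances `hBt`, `hmixt`). -/
theorem T2Of_val_succ_translate (j : ℕ) (κ : Fin (d + 1)) (u : Fin (d + 1) → ℤ) (κ' : Fin (d + 1)) (u' t : Fin (d + 1) → ℤ) :
    (cE₂ * wV4 d Lc (j + 1)) • e4OfW d Lc j (Spure d Lc cE cVH cΛ j) (M1 d Lc cΛ j)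
        (WbalOf d Lc cE cVH cΛ (T2Of d Lc cE cVH cΛ cE₂ cB T vh₂S mixFF) mixFF j) κ (u + t) κ' (u' + t)
      = shiftK (-t) ((cE₂ * wV4 d Lc (j + 1)) • e4OfW d Lc j (Spure d Lc cE cVH cΛ j) (M1 d Lc cΛ j)
        (WbalOf d Lc cE cVH cΛ (T2Of d Lc cE cVH cΛ cE₂ cB T vh₂S mixFF) mixFF j) κ u κ' u') := by
  rw [e4OfW_translate j (Spure_translate hLc cE cVH cΛ j) (M1_translate (Lc := Lc) cΛ j)
    (WbalOf_translate hLc cE cVH cΛ (T2Of_translate hLc cE cVH cΛ cE₂ cB T hBt hmixt) hmixt j)]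
  rfl

include hLc hBt hBff hmixt in
/-- [folklore] **EVERY MEMBER OF an2's `T2Of` IS COVARIANT UNDER ALL UNIT TRANSLATIONS ON THE FIELD–FIELD BLOCK** — the value part by
`wilsonW₂_slot_translate` / `T2Of_val_succ_translate`, the border contributing nothing there (`mfNeg_inl_inl`, `hBff`). -/
theorem T2Of_ff_translate :
    ∀ (j : ℕ) (α β κ : Fin (d + 1)) (u : Fin (d + 1) → ℤ) (κ' : Fin (d + 1)) (u' t x z : Fin (d + 1) → ℤ),
      T2Of d Lc cE cVH cΛ cE₂ cB T vh₂S mixFF j κ (u + t) κ' (u' + t) x z (Sum.inl α) (Sum.inl β)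
        = T2Of d Lc cE cVH cΛ cE₂ cB T vh₂S mixFF j κ u κ' u' (x + -t) (z + -t) (Sum.inl α) (Sum.inl β)
  | 0, α, β, κ, u, κ', u', t, x, z => by
    simp only [T2Of_zero, Pi.add_apply, Pi.smul_apply, smul_eq_mul, mfNeg_inl_inl, hBff, mul_zero, add_zero]
    rw [wilsonW₂_slot_translate]
  | j + 1, α, β, κ, u, κ', u', t, x, z => by
    have hv := slot_translate_of_translate
      (X := fun κ u κ' u' => (cE₂ * wV4 d Lc (j + 1)) • e4OfW d Lc j (Spure d Lc cE cVH cΛ j) (M1 d Lc cΛ j)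
        (WbalOf d Lc cE cVH cΛ (T2Of d Lc cE cVH cΛ cE₂ cB T vh₂S mixFF) mixFF j) κ u κ' u')
      (fun κ u κ' u' t => T2Of_val_succ_translate hLc cE cVH cΛ cE₂ cB T hBt hmixt j κ u κ' u' t)
      (Sum.inl α) (Sum.inl β) κ u κ' u' t x z
    simp only [Pi.smul_apply, smul_eq_mul] at hv
    simp only [T2Of_succ, Pi.add_apply, Pi.smul_apply, smul_eq_mul, mfNeg_inl_inl, hBff, mul_zero, add_zero]
    exact hv

include hLc hBt hBff hmixt in
/-- [folklore] **THE NORMALISED MEMBERS `unitS₂ s_f s_m (T2Of … j)` ARE FIELD–FIELD SLOT COVARIANT** (any real units; in particular the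
END's `T♮_j := unitS₂ (sfStep Lc j) (smStep d Lc j) (T2Of … j)`). -/
theorem unitS₂_T2Of_ff_translate (sf sm : ℝ) (j : ℕ) (α β κ : Fin (d + 1)) (u : Fin (d + 1) → ℤ) (κ' : Fin (d + 1))
    (u' t x z : Fin (d + 1) → ℤ) :
    unitS₂ sf sm (T2Of d Lc cE cVH cΛ cE₂ cB T vh₂S mixFF j) κ (u + t) κ' (u' + t) x z (Sum.inl α) (Sum.inl β)
      = unitS₂ sf sm (T2Of d Lc cE cVH cΛ cE₂ cB T vh₂S mixFF j) κ u κ' u' (x + -t) (z + -t) (Sum.inl α) (Sum.inl β) :=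
  unitS₂_slot_translate sf sm (T2Of_ff_translate hLc cE cVH cΛ cE₂ cB T hBt hBff hmixt j α β) κ u κ' u' t x z

include hLc hBt hBff hmixt in
/-- [folklore] **EVERY FIRST DIFFERENCE `T♮_{n+1} − T♮_n` OF THE NORMALISED TOWER IS FIELD–FIELD SLOT COVARIANT** (the `D n` of the
owner's END `WSlotT2OfPieces.t2Drift_of_rows`, written as there). -/
theorem firstDiff_ff_translate (n : ℕ) (α β κ : Fin (d + 1)) (u : Fin (d + 1) → ℤ) (κ' : Fin (d + 1))
    (u' t x z : Fin (d + 1) → ℤ) :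
    (fun κ u κ' u' => unitS₂ (sfStep Lc (n + 1)) (smStep d Lc (n + 1)) (T2Of d Lc cE cVH cΛ cE₂ cB T vh₂S mixFF (n + 1)) κ u κ' u'
        - unitS₂ (sfStep Lc n) (smStep d Lc n) (T2Of d Lc cE cVH cΛ cE₂ cB T vh₂S mixFF n) κ u κ' u') κ (u + t) κ' (u' + t) x z
        (Sum.inl α) (Sum.inl β)
      = (fun κ u κ' u' => unitS₂ (sfStep Lc (n + 1)) (smStep d Lc (n + 1)) (T2Of d Lc cE cVH cΛ cE₂ cB T vh₂S mixFF (n + 1)) κ u κ' u'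
        - unitS₂ (sfStep Lc n) (smStep d Lc n) (T2Of d Lc cE cVH cΛ cE₂ cB T vh₂S mixFF n) κ u κ' u') κ u κ' u' (x + -t) (z + -t)
        (Sum.inl α) (Sum.inl β) :=
  slot_translate_sub (unitS₂_T2Of_ff_translate hLc cE cVH cΛ cE₂ cB T hBt hBff hmixt _ _ (n + 1) α β)
    (unitS₂_T2Of_ff_translate hLc cE cVH cΛ cE₂ cB T hBt hBff hmixt _ _ n α β) κ u κ' u' t x z

/-! ## §3 The cell ⟷ pointwise bridges for the normalised members and the first differences -/

include hLc hBt hBff hmixt in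
/-- [folklore] **CELL ⟷ POINTWISE ff ZERO MODE FOR EVERY NORMALISED MEMBER** `unitS₂ s_f s_m (T2Of … j)` (any units, `N ≠ 0`): leaf-02's
`∀ κ κ′ α β, zmode N (…) κ κ′ (inl α) (inl β) = 0` ⟺ the pointwise `Zfree` of record. -/
theorem zmode_ff_unitS₂_T2Of_iff_pointwise {N : ℕ} (hN : N ≠ 0) (sf sm : ℝ) (j : ℕ) :
    (∀ (κ κ' α β : Fin (d + 1)),
        zmode N (unitS₂ sf sm (T2Of d Lc cE cVH cΛ cE₂ cB T vh₂S mixFF j)) κ κ' (Sum.inl α) (Sum.inl β) = 0) ↔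
      ∀ (κ : Fin (d + 1)) (u : Fin (d + 1) → ℤ) (κ' α β : Fin (d + 1)),
        (∑' u', ∑' x, ∑' z, unitS₂ sf sm (T2Of d Lc cE cVH cΛ cE₂ cB T vh₂S mixFF j) κ u κ' u' x z (Sum.inl α) (Sum.inl β)) = 0 :=
  zmode_ff_eq_zero_iff_pointwise_of_ff hN fun α β => unitS₂_T2Of_ff_translate hLc cE cVH cΛ cE₂ cB T hBt hBff hmixt sf sm j α β

include hLc hBt hBff hmixt in
/-- [folklore] The same for the RAW members `T2Of … j`. -/
theorem zmode_ff_T2Of_iff_pointwise {N : ℕ} (hN : N ≠ 0) (j : ℕ) :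
    (∀ (κ κ' α β : Fin (d + 1)), zmode N (T2Of d Lc cE cVH cΛ cE₂ cB T vh₂S mixFF j) κ κ' (Sum.inl α) (Sum.inl β) = 0) ↔
      ∀ (κ : Fin (d + 1)) (u : Fin (d + 1) → ℤ) (κ' α β : Fin (d + 1)),
        (∑' u', ∑' x, ∑' z, T2Of d Lc cE cVH cΛ cE₂ cB T vh₂S mixFF j κ u κ' u' x z (Sum.inl α) (Sum.inl β)) = 0 :=
  zmode_ff_eq_zero_iff_pointwise_of_ff hN fun α β => T2Of_ff_translate hLc cE cVH cΛ cE₂ cB T hBt hBff hmixt j α β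

include hLc hBt hBff hmixt in
/-- [folklore] **CELL ⟷ POINTWISE ff ZERO MODE FOR EVERY FIRST DIFFERENCE** `T♮_{n+1} − T♮_n` of the normalised tower (`N ≠ 0`) — leaf-07's
cell-form `WSlotFirstDiff.hZ0_iff_chargeConserved` and the pointwise `hZ0` of the END become inter-derivable (`n = 0`, `N = Lc`). -/
theorem zmode_ff_firstDiff_iff_pointwise {N : ℕ} (hN : N ≠ 0) (n : ℕ) :
    (∀ (κ κ' α β : Fin (d + 1)),
        zmode N (fun κ u κ' u' =>
            unitS₂ (sfStep Lc (n + 1)) (smStep d Lc (n + 1)) (T2Of d Lc cE cVH cΛ cE₂ cB T vh₂S mixFF (n + 1)) κ u κ' u'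
              - unitS₂ (sfStep Lc n) (smStep d Lc n) (T2Of d Lc cE cVH cΛ cE₂ cB T vh₂S mixFF n) κ u κ' u')
          κ κ' (Sum.inl α) (Sum.inl β) = 0) ↔
      ∀ (κ : Fin (d + 1)) (u : Fin (d + 1) → ℤ) (κ' α β : Fin (d + 1)),
        (∑' u', ∑' x, ∑' z,
          (unitS₂ (sfStep Lc (n + 1)) (smStep d Lc (n + 1)) (T2Of d Lc cE cVH cΛ cE₂ cB T vh₂S mixFF (n + 1)) κ u κ' u'
              - unitS₂ (sfStep Lc n) (smStep d Lc n) (T2Of d Lc cE cVH cΛ cE₂ cB T vh₂S mixFF n) κ u κ' u') x z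
            (Sum.inl α) (Sum.inl β)) = 0 :=
  zmode_ff_eq_zero_iff_pointwise_of_ff hN fun α β => firstDiff_ff_translate hLc cE cVH cΛ cE₂ cB T hBt hBff hmixt n α β

end Members

end Summit.QuantumFields.BalabanUV.Beta.GAN24.T2OfValueCovariance

end
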